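import Summits.QuantumFields.YangMills.Theorems.UnitScaleGibbsBlockPlaquetteLinWeightDefs
import Literature.MathematicalPhysics.QuantumFieldTheory.Balaban1983to89.BlockAveragingEMLLinearised
import HarnessLib

/-!
# `UnitScaleGibbsBlockPlaquetteLinWeightDecay` — THE COLUMN SUMS OF THE NESTED OFFSET-MEAN WEIGHTS: `Σ_a linWeight j a p = (L²∕L^d)^j`, HENCE
# `linWeight j a p ≤ (L²∕L^d)^j` (= `L^{−j}` in `d = 3`) — brick (W-P4) of the S_lin stub of the crux idea «gross-sd-transfer», LINE 28 candidate

Cell `ym3-torus` (YM ladder rung R3 = continuum SU(2) Yang–Mills on T³ — a RUNG, NOT the Clay problem: not d = 4, not infinite volume, not a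
mass gap), crux of record `UnitScaleTilt.HistoryTailL` (stmt-QuantumFields-19936), width seat `ym-ust-19936-w2` (gen 14).  Companion of
✓`UnitScaleGibbsBlockPlaquetteLinWeightDefs` (p736301: the weights `linWeight j a p`, `Σ_p linWeight j a p = (L·L)^j`) and
`UnitScaleGibbsBlockPlaquetteTransportFreeLinearisation` (the `j`-fold bound); `GrossTransferAnnex4.md` §6 «stub_lin».

WHY (load-bearing).  The variance scale of the LINE 28 candidate is `‖h_a‖₂² ≍ L^{j}` for the weights `h_a = linWeight j a` of the block plaquette `a`
(annex 1 §0: «`‖h‖₂² = c_L·L^{j}`, and `β_K·g² = L^{j}`»).  The ROW sum `Σ_p h_a(p) = L^{2j}` (✓`sum_linWeight`) alone gives only `‖h‖₂² ≤ L^{4j}·(max)`; the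
missing input is the DECAY `h_a(p) ≤ L^{−j}`, whence `‖h_a‖₂² ≤ max_p h_a(p) · Σ_p h_a(p) ≤ L^{−j}·L^{2j} = L^{j}`.  The decay is a COLUMN-SUM identity:
summing over ALL coarse plaquettes `a` instead of over fine plaquettes `p`, each averaging level contributes the factor `L²∕L^d` (the `L²` tiles against
the `L^d` block offsets), because for every tile position `(t, s)` the map `(y, r) ↦ blockSite y r + t e_ν + s e_μ` is a BIJECTION of
`Site P (j+1) × (Fin L)^d` onto `Site P j` — Bałaban's block decomposition [Balaban1987RG1] (0.1)∕(0.3) (every fine site is exactly one block's site at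
exactly one offset), in the tree as ✓`Site.blockEquiv` ∕ ✓`Site.blockOf_blockSite` (standing range `j + 1 ≤ m + K`) and the staircase endpoint letter
✓`BlockAveragingEMLLinearised.walkEnd_emb_stairWord_eq_blockSite`.

WHAT THIS FILE PROVES (kernel; 0 `def`, 0 `sorry`):
* §1 reindexing letters: `sum_shift_eq` ∕ `sum_shiftN_eq` (translation invariance of site sums, ✓`LatticeFieldCalculus.shiftEquiv`), ★`sum_site_succ_offset_eq`
  (`Σ_{y} Σ_{r} g (blockSite y r) = Σ_{x} g x`, the block bijection), `sum_plaq_eq_sum_site_dite` (a plaquette sum is a site sum of a `μ < ν`-guarded sum).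
* §2 ★★ `sum_linWeight_col_succ` (one level: `Σ_{a′} linWeight (j+1) a′ p = (L²∕L^d) · Σ_{a} linWeight j a p`), ★★★ `sum_linWeight_col`
  (`Σ_a linWeight j a p = (L²∕L^d)^j`, `j ≤ m + K`), ★★★ `linWeight_le` (`linWeight j a p ≤ (L²∕L^d)^j`), and the `ℓ²` consequence
  ★★ `sum_linWeight_sq_le` (`Σ_p (linWeight j a p)² ≤ (L²∕L^d)^j · (L·L)^j` — in `d = 3`: `≤ L^{j}`).

HONEST FRAMING.  Lattice combinatorics of the tree's own weights (`--supports stmt-QuantumFields-19936`); proves no stub, crux, rung or summit statement;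
stub_lin (LOCAL form, `dist₁`∕flux identification), «ShallowFluxSecondMomentL», (Q), K1, `MeanDeviationL`, `HistoryTailL` are NOT proved; the Yang–Mills
mass gap is NOT proved.

References: [Balaban1987RG1] T. Bałaban, CMP 109 (1987) 249–301, (0.1), (0.3) pp. 251–252; [Balaban1985Averaging] T. Bałaban, CMP 98 (1985) 17–51, (48) p. 26.
-/

noncomputable section

open scoped BigOperators

namespace Summit.QuantumFields.YangMills.Theorems.UnitScaleGibbsBlockPlaquetteLinWeight

open Literature.MathematicalPhysics.QuantumFieldTheory.Balaban1983to89
open Literature.MathematicalPhysics.QuantumFieldTheory.Balaban1983to89.B10Eq47AxialChi (shiftN shiftN_succ)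
open Literature.MathematicalPhysics.QuantumFieldTheory.Balaban1983to89.BlockAveraging (off)
open Literature.MathematicalPhysics.QuantumFieldTheory.Balaban1983to89.BlockAveragingEMLLinearised (walkEnd_emb_stairWord_eq_blockSite)
open T4Continuum (walkEnd stairWord)

variable {P : Params} {j : ℕ}

/-! ## §1 Reindexing letters -/

section Reindex

variable {𝕄 : Type*} [AddCommMonoid 𝕄]

/-- Translation invariance of site sums: `Σ_x g (x + e_μ) = Σ_x g x`. [folklore] -/
theorem sum_shift_eq (μ : Fin P.d) (g : Site P j → 𝕄) : ∑ x : Site P j, g (x.shift μ) = ∑ x : Site P j, g x :=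
  Equiv.sum_comp (LatticeFieldCalculus.shiftEquiv (j := j) μ) g

/-- Translation invariance, iterated: `Σ_x g (x + t e_μ) = Σ_x g x`. [folklore] -/
theorem sum_shiftN_eq (μ : Fin P.d) : ∀ (t : ℕ) (g : Site P j → 𝕄), ∑ x : Site P j, g (shiftN x μ t) = ∑ x : Site P j, g x
  | 0, g => rfl
  | t + 1, g => by
    have h := sum_shiftN_eq μ t (fun x => g (x.shift μ))
    simp only [shiftN_succ]
    rw [h, sum_shift_eq]

/-- **THE BLOCK BIJECTION AS A SUM IDENTITY**: `Σ_{y : T^{(j+1)}} Σ_{r ∈ (Fin L)^d} g (blockSite y r) = Σ_{x : T^{(j)}} g x` — every fine site is exactly one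
block's site at exactly one offset (standing range `j + 1 ≤ m + K`). [cite: Balaban1987RG1, (0.1) and (0.3) pp.251-252] -/
theorem sum_site_succ_offset_eq (hj : j + 1 ≤ P.m + P.K) (g : Site P j → 𝕄) :
    ∑ y : Site P (j + 1), ∑ r : Fin P.d → Fin P.L, g (Site.blockSite y r) = ∑ x : Site P j, g x := by
  classical
  rw [← Finset.sum_fiberwise (s := (Finset.univ : Finset (Site P j))) (g := blockOf) (f := g)]
  refine Finset.sum_congr rfl fun y _ => ?_
  have hmem : ∀ x : Site P j, blockOf x = y ↔ x ∈ Finset.univ.filter (fun x : Site P j => blockOf x = y) := fun x => by simp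
  let e : (Fin P.d → Fin P.L) ≃ ↥(Finset.univ.filter (fun x : Site P j => blockOf x = y)) :=
    (Site.blockEquiv hj y).symm.trans (Equiv.subtypeEquivRight hmem)
  rw [← Finset.sum_coe_sort (Finset.univ.filter (fun x : Site P j => blockOf x = y)) g, ← Equiv.sum_comp e (fun i => g i.1)]
  rfl

/-- Pushing a site sum through the `μ < ν` guard: `Σ_x Σ_μ Σ_ν [μ<ν] f = Σ_μ Σ_ν [μ<ν] Σ_x f`. [folklore] -/
theorem sum_site_dite_comm {k : ℕ} (f : Site P k → (μ ν : Fin P.d) → μ < ν → 𝕄) :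
    ∑ x : Site P k, ∑ μ : Fin P.d, ∑ ν : Fin P.d, (if h : μ < ν then f x μ ν h else 0) =
      ∑ μ : Fin P.d, ∑ ν : Fin P.d, if h : μ < ν then ∑ x : Site P k, f x μ ν h else 0 := by
  rw [Finset.sum_comm]
  refine Finset.sum_congr rfl fun μ _ => ?_
  rw [Finset.sum_comm]
  refine Finset.sum_congr rfl fun ν _ => ?_
  by_cases h : μ < ν
  · simp only [dif_pos h]
  · simp only [dif_neg h, Finset.sum_const_zero]

/-- A plaquette sum is a site sum of the `μ < ν`-guarded direction sum. [folklore] -/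
theorem sum_plaq_eq_sum_site_dite {k : ℕ} (F : Plaq P k → 𝕄) :
    ∑ a : Plaq P k, F a = ∑ x : Site P k, ∑ μ : Fin P.d, ∑ ν : Fin P.d, if h : μ < ν then F ⟨x, μ, ν, h⟩ else 0 := by
  classical
  let e : Plaq P k ≃ {t : Site P k × Fin P.d × Fin P.d // t.2.1 < t.2.2} :=
    ⟨fun q => ⟨(q.src, q.μ, q.ν), q.hμν⟩, fun t => ⟨t.1.1, t.1.2.1, t.1.2.2, t.2⟩, fun _ => rfl, fun _ => rfl⟩
  let f : Site P k × Fin P.d × Fin P.d → 𝕄 := fun t => if h : t.2.1 < t.2.2 then F ⟨t.1, t.2.1, t.2.2, h⟩ else 0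
  have h1 : ∑ a : Plaq P k, F a = ∑ t : {t : Site P k × Fin P.d × Fin P.d // t.2.1 < t.2.2}, f t.1 := by
    rw [← Equiv.sum_comp e.symm F]
    refine Finset.sum_congr rfl fun t _ => ?_
    simp only [f, dif_pos t.2]
    rfl
  have h2 : ∑ t : {t : Site P k × Fin P.d × Fin P.d // t.2.1 < t.2.2}, f t.1 =
      ∑ t ∈ Finset.univ.filter (fun t : Site P k × Fin P.d × Fin P.d => t.2.1 < t.2.2), f t :=
    (Finset.sum_subtype (Finset.univ.filter (fun t : Site P k × Fin P.d × Fin P.d => t.2.1 < t.2.2)) (by simp) f).symm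
  have h3 : ∑ t ∈ Finset.univ.filter (fun t : Site P k × Fin P.d × Fin P.d => t.2.1 < t.2.2), f t =
      ∑ t : Site P k × Fin P.d × Fin P.d, f t :=
    Finset.sum_filter_of_ne fun t _ hft => by
      by_contra hc
      exact hft (by simp only [f, dif_neg hc])
  rw [h1, h2, h3, Fintype.sum_prod_type]
  refine Finset.sum_congr rfl fun x _ => ?_
  rw [Fintype.sum_prod_type]

end Reindex

/-! ## §2 The column sums and the decay -/

/-- **ONE LEVEL OF THE COLUMN SUM**: `Σ_{a′ : Plaq P (j+1)} linWeight (j+1) a′ p = (L²∕L^d) · Σ_{a : Plaq P j} linWeight j a p` — the `|J|⁻¹`-weighted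
sum over the coupled index and the tiles, summed over all coarse plaquettes, counts every level-`j` plaquette exactly `|Perm|⁴·L²` times (block bijection
per tile position, translation invariance), against `|J| = L^d·|Perm|⁴`. [cite: Balaban1987RG1, (0.1) and (0.3) pp.251-252; Balaban1985Averaging, (48) p.26] -/
theorem sum_linWeight_col_succ (hj : j + 1 ≤ P.m + P.K) (p : Plaq P 0) :
    ∑ a : Plaq P (j + 1), linWeight (j + 1) a p =
      ((P.L : ℝ) * P.L * (((P.L : ℝ) ^ P.d)⁻¹)) * ∑ a : Plaq P j, linWeight j a p := by
  classical
  haveI : Nonempty (Fin P.d → Fin P.L) := ⟨fun _ => ⟨0, P.L_pos⟩⟩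
  -- the index `J = (r, σ, τ, ρ, ω)`: only `r` matters
  have hJ : ∀ (y : Site P (j + 1)) (μ ν : Fin P.d) (h : μ < ν),
      (∑ J : (Fin P.d → Fin P.L) × Equiv.Perm (Fin P.d) × Equiv.Perm (Fin P.d) × Equiv.Perm (Fin P.d) × Equiv.Perm (Fin P.d),
        ∑ t ∈ Finset.range P.L, ∑ s ∈ Finset.range P.L,
          linWeight j ⟨shiftN (shiftN (Site.blockSite y J.1) ν t) μ s, μ, ν, h⟩ p) =
      (Fintype.card (Equiv.Perm (Fin P.d)) : ℝ) ^ 4 *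
        ∑ r : Fin P.d → Fin P.L, ∑ t ∈ Finset.range P.L, ∑ s ∈ Finset.range P.L,
          linWeight j ⟨shiftN (shiftN (Site.blockSite y r) ν t) μ s, μ, ν, h⟩ p := by
    intro y μ ν h
    simp only [Fintype.sum_prod_type, Finset.sum_const, Finset.card_univ, nsmul_eq_mul, Fintype.card_prod, Nat.cast_mul]
    rw [Finset.mul_sum]
    refine Finset.sum_congr rfl fun r _ => ?_
    ring
  -- block bijection and translation invariance per `(μ, ν, t, s)`
  have key : ∀ (μ ν : Fin P.d) (h : μ < ν),
      (∑ y : Site P (j + 1), ∑ r : Fin P.d → Fin P.L, ∑ t ∈ Finset.range P.L, ∑ s ∈ Finset.range P.L,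
          linWeight j ⟨shiftN (shiftN (Site.blockSite y r) ν t) μ s, μ, ν, h⟩ p) =
        ((P.L : ℝ) * P.L) * ∑ x : Site P j, linWeight j ⟨x, μ, ν, h⟩ p := by
    intro μ ν h
    rw [sum_site_succ_offset_eq hj (fun x => ∑ t ∈ Finset.range P.L, ∑ s ∈ Finset.range P.L,
      linWeight j ⟨shiftN (shiftN x ν t) μ s, μ, ν, h⟩ p)]
    rw [Finset.sum_comm]
    calc ∑ t ∈ Finset.range P.L, ∑ x : Site P j, ∑ s ∈ Finset.range P.L, linWeight j ⟨shiftN (shiftN x ν t) μ s, μ, ν, h⟩ p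
        = ∑ t ∈ Finset.range P.L, ∑ s ∈ Finset.range P.L, ∑ x : Site P j, linWeight j ⟨x, μ, ν, h⟩ p := by
          refine Finset.sum_congr rfl fun t _ => ?_
          rw [Finset.sum_comm]
          refine Finset.sum_congr rfl fun s _ => ?_
          exact (sum_shiftN_eq ν t (fun z => linWeight j ⟨shiftN z μ s, μ, ν, h⟩ p)).trans
            (sum_shiftN_eq μ s (fun z => linWeight j ⟨z, μ, ν, h⟩ p))
      _ = ((P.L : ℝ) * P.L) * ∑ x : Site P j, linWeight j ⟨x, μ, ν, h⟩ p := by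
          simp [Finset.sum_const, Finset.card_range]; ring
  have hcard : (Fintype.card ((Fin P.d → Fin P.L) × Equiv.Perm (Fin P.d) × Equiv.Perm (Fin P.d) × Equiv.Perm (Fin P.d) ×
      Equiv.Perm (Fin P.d)) : ℝ) = (P.L : ℝ) ^ P.d * (Fintype.card (Equiv.Perm (Fin P.d)) : ℝ) ^ 4 := by
    simp only [Fintype.card_prod, Fintype.card_fun, Fintype.card_fin, Nat.cast_mul, Nat.cast_pow]
    ring
  have hPerm : (Fintype.card (Equiv.Perm (Fin P.d)) : ℝ) ≠ 0 := Nat.cast_ne_zero.mpr Fintype.card_ne_zero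
  have hLd : (P.L : ℝ) ^ P.d ≠ 0 := pow_ne_zero _ (Nat.cast_ne_zero.mpr P.L_pos.ne')
  -- unfold one level, pass to guarded site sums, push the sums inside the guard, compare termwise
  simp only [linWeight_succ, walkEnd_emb_stairWord_eq_blockSite]
  rw [← Finset.mul_sum, sum_plaq_eq_sum_site_dite, sum_plaq_eq_sum_site_dite (k := j)]
  simp_rw [hJ]
  rw [hcard, sum_site_dite_comm, sum_site_dite_comm, Finset.mul_sum, Finset.mul_sum]
  refine Finset.sum_congr rfl fun μ _ => ?_
  rw [Finset.mul_sum, Finset.mul_sum]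
  refine Finset.sum_congr rfl fun ν _ => ?_
  by_cases h : μ < ν
  · rw [dif_pos h, dif_pos h, ← Finset.mul_sum, key μ ν h]
    field_simp
  · rw [dif_neg h, dif_neg h, mul_zero, mul_zero]

/-- **THE COLUMN-SUM IDENTITY** `Σ_{a : Plaq P j} linWeight j a p = (L²∕L^d)^j` (standing range `j ≤ m + K`): summed over ALL coarse plaquettes, the
weight of a fixed fine plaquette shrinks by `L²∕L^d` per level. [cite: Balaban1987RG1, (0.1) and (0.3) pp.251-252; Balaban1985Averaging, (48) p.26] -/
theorem sum_linWeight_col : ∀ {j : ℕ} (_ : j ≤ P.m + P.K) (p : Plaq P 0),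
    ∑ a : Plaq P j, linWeight j a p = ((P.L : ℝ) * P.L * (((P.L : ℝ) ^ P.d)⁻¹)) ^ j
  | 0, _, p => by
    classical
    rw [pow_zero, Finset.sum_eq_single p (fun a _ ha => linWeight_zero_of_ne ha) (fun h => absurd (Finset.mem_univ p) h),
      linWeight_zero_self]
  | j + 1, hj, p => by
    rw [sum_linWeight_col_succ hj p, sum_linWeight_col (Nat.le_of_succ_le hj) p, pow_succ]
    ring

/-- ★★★ **THE DECAY** `linWeight j a p ≤ (L²∕L^d)^j` (one nonnegative term of the column sum; `= L^{−j}` in `d = 3`) — the load-bearing input for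
`‖linWeight j a‖₂² ≍ L^{(2−(d−2))j}`. [cite: Balaban1987RG1, (0.1) and (0.3) pp.251-252] -/
theorem linWeight_le (hj : j ≤ P.m + P.K) (a : Plaq P j) (p : Plaq P 0) :
    linWeight j a p ≤ ((P.L : ℝ) * P.L * (((P.L : ℝ) ^ P.d)⁻¹)) ^ j := by
  classical
  rw [← sum_linWeight_col hj p]
  exact Finset.single_le_sum (f := fun a' => linWeight j a' p) (fun a' _ => linWeight_nonneg j a' p) (Finset.mem_univ a)

/-- ★★ **THE `ℓ²` SIZE OF THE WEIGHTS**: `Σ_p (linWeight j a p)² ≤ (L²∕L^d)^j · (L·L)^j` (decay × row sum; in `d = 3`: `≤ L^{j}`, annex 1's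
`‖h_a‖₂² ≍ c_L·L^{j}` with `c_L ≤ 1`). [cite: Balaban1985Averaging, (48) p.26] -/
theorem sum_linWeight_sq_le (hj : j ≤ P.m + P.K) (a : Plaq P j) :
    ∑ p : Plaq P 0, linWeight j a p ^ 2 ≤ ((P.L : ℝ) * P.L * (((P.L : ℝ) ^ P.d)⁻¹)) ^ j * ((P.L : ℝ) * P.L) ^ j := by
  rw [← sum_linWeight j a, Finset.mul_sum]
  refine Finset.sum_le_sum fun p _ => ?_
  rw [sq]
  exact mul_le_mul_of_nonneg_right (linWeight_le hj a p) (linWeight_nonneg j a p)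

end Summit.QuantumFields.YangMills.Theorems.UnitScaleGibbsBlockPlaquetteLinWeight

end
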